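import Summits.QuantumFields.BalabanUV.T4Continuum.Support.NE7CovariantInteriorGradientSharp
import HarnessLib

/-!
# NE7CovariantOneFormSupRegularity — THE 1-FORM SUP-GRADIENT ESTIMATE AT A CURVED BACKGROUND FROM HODGE DATA (memo §7 (b), the first (L2)-preparatory brick): for a
# site-framed periodic bond field `A` at a unitary periodic `W` of the class (plaquettes within `x`, covariant plaquette gradients within `x₁`), with sup `U`, curl
# co-differential `‖Σ_μ ∇_μ^†(∇_μA_ν − ∇_νA_μ)‖ ≤ J` and divergence gradient `‖∇_ν(div_W A)‖ ≤ P`, every `R ≥ 1` with `16dR·a ≤ 1` (`a = 2d(R+1)x`):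
# `‖∇_W A‖_∞ ≤ 4(dU∕R + R(J + P + 2dxU)) + (4R(2δ + 12da²) + 4a)·U`, `δ = 2d²(R+1)x₁ + 8d³(R+1)²x²` — F116b ∘ F117 with the a priori gradient absorbed on the torus; file 56

Cell `pub-balaban`, rung (B)+1 sub-cell t4, lineage `b2b-balaban-t4-ne7-p1` (CRUX PROVER NE7 #1 = OWNER of row NE7), generation 79; memo `t4/b2b-balaban-t4-ne7-p1-g79/GRADIENT-LETTER.md` §7.
File F125 (over F116b `NE7CovariantInteriorGradientSharp.norm_cD_le_of_covLap_sharp`, F117 `NE7CovariantHodgeBond.norm_covLap_le_hodge`, `NE3CovariantCalculus.cD_periodic`).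
WHY.  The curved slice solver (L2) will need, before anything about the slice, the 1-form twin of pub-balaban-gaps ne3's (H0_W): control of the covariant gradient of a bond field by
the SUP data of its Hodge Laplacian `δ_W d_W + d_W δ_W` at a curved background, with the curvature entering only through level-free smalls.  F121b did this for the SPECIFIC field
`frame W Z` with the curl co-differential routed through plaquette variables (F119∕F120); THIS file is the generic statement with the curl co-differential as a PRIMITIVE datum —
what a Green's-function argument on the slice would feed.  With a sup SHAPE `U ≤ C_U·M·G` for `W`-tangent fields (memo §7 (a), not in the tree) it becomes a genuine (H0_W)
for 1-forms (`G ≤ 4R(J + P)∕(1 − line)`).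
WHAT ([folklore]; 0 def, 0 sorry).  **`norm_cD_le_hodge_periodic`** (displayed above).
HONEST FRAMING (page 1): elementary lattice analysis of OUR objects at one configuration; `J`, `P`, `U` HYPOTHESES; nothing of Bałaban's asserted; (L2) NOT touched; NOT ONE-STEP,
NOT NE7; spine 0∕9; finite T⁴ rung (B)+1 — NOT infinite volume, NOT mass gap, NOT `BetaPertH`, NOT Clay.  Continuum YM on T⁴ ⇐ BetaPertH ∧ nine spine estimates (0/9 proved);
BetaPertH ⇐ (D1) ∧ (D4) ∧ CAP+tail; G-an2-4 gates asym, D1 and NE2/3/4.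
-/

set_option autoImplicit false

open scoped BigOperators Matrix Matrix.Norms.L2Operator
open NormedSpace Finset

namespace Summit.QuantumFields.BalabanUV.T4Continuum.NE7CovariantOneFormSupRegularity

open Literature.MathematicalPhysics.QuantumFieldTheory.Balaban1983to89
open B7Prop1Explicit B7Prop2Explicit
open T4AveragingDeficitWall (Ad IsUnitaryCfg SmallField)
open T4AveragingDeficitWallBoundary (IsPeriodicCfg periodBox mem_periodBox)
open AveragingDeficitTorusChart (periodic_smul_vec)
open SkeletonLattice (cmod smul_cdiv_add_cmod cmod_nonneg cmod_lt)
open NE3CovariantCalculus (cD cDstar cdiv cD_periodic)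
open NE7CovariantHodgeBond (norm_covLap_le_hodge)
open NE7CovariantInteriorGradientSharp (norm_cD_le_of_covLap_sharp)

noncomputable section

variable {d : ℕ} {n : Type*} [Fintype n] [DecidableEq n]

/-- **THE 1-FORM SUP-GRADIENT ESTIMATE AT A CURVED BACKGROUND FROM HODGE DATA.**  `d ≥ 1`; `W` unitary, `Per`-periodic (`Per ≥ 1`), `SmallField W x`, covariant plaquette
gradients `≤ x₁`; `A : ℤᵈ → (Fin d → 𝕄)` site-framed, `Per`-periodic, `‖A‖ ≤ U`; `‖Σ_μ ∇_μ^†(∇_μA_ν − ∇_νA_μ)(y)‖ ≤ J` and `‖∇_ν(cdiv W A)(y)‖ ≤ P` everywhere; `R ≥ 1` with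
`16dR·a ≤ 1`, `a = 2d(R+1)x`.  Then every covariant forward difference obeys
`‖∇_τ A_ν(y)‖ ≤ 4(dU∕R + R(J + P + 2dxU)) + (4R(2δ + 12da²) + 4a)·U`, `δ = 2d²(R+1)x₁ + 8d³(R+1)²x²`. [folklore] -/
theorem norm_cD_le_hodge_periodic [Nonempty n] (hd : 1 ≤ d) {Per : ℕ} (hPer : 1 ≤ Per)
    {W : Site d → Fin d → (Matrix n n ℂ)ˣ} (hW : IsUnitaryCfg W) (hWP : IsPeriodicCfg W (Per : ℤ)) {x x₁ : ℝ} (hx : 0 ≤ x) (hx₁ : 0 ≤ x₁)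
    (hWx : SmallField W x)
    (hgrad : ∀ (p : Site d) (μ κ : Fin d), κ ≠ μ →
      ‖Ad (W p μ) ((hol W (p + e μ) (plaqWord κ μ) : (Matrix n n ℂ)ˣ) : Matrix n n ℂ) - ((hol W p (plaqWord κ μ) : (Matrix n n ℂ)ˣ) : Matrix n n ℂ)‖ ≤ x₁)
    (A : Site d → Fin d → Matrix n n ℂ) (hAP : ∀ (y : Site d) (κ ν : Fin d), A (y + (Per : ℤ) • e κ) ν = A y ν)
    {U J P : ℝ} (hU : ∀ y κ, ‖A y κ‖ ≤ U)
    (hJ : ∀ (y : Site d) (ν : Fin d), ‖∑ μ, cDstar W μ (fun z => cD W μ (fun w => A w ν) z - cD W ν (fun w => A w μ) z) y‖ ≤ J)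
    (hP : ∀ (y : Site d) (ν : Fin d), ‖cD W ν (cdiv W A) y‖ ≤ P)
    {R : ℕ} (hR : 1 ≤ R) (hsmall : 16 * (d : ℝ) * R * (2 * (d : ℝ) * (R + 1) * x) ≤ 1) (y : Site d) (τ ν : Fin d) :
    ‖cD W τ (fun w => A w ν) y‖
      ≤ 4 * ((d : ℝ) * U / R + R * (J + P + 2 * d * x * U))
        + (4 * R * (2 * (2 * (d : ℝ) ^ 2 * (R + 1) * x₁ + 8 * (d : ℝ) ^ 3 * ((R : ℝ) + 1) ^ 2 * x ^ 2) + 12 * (d : ℝ) * (2 * (d : ℝ) * (R + 1) * x) ^ 2)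
            + 4 * (2 * (d : ℝ) * (R + 1) * x)) * U := by
  classical
  -- the maximal covariant forward difference over one period
  set S : Finset (Site d × Fin d × Fin d) :=
    (periodBox (d := d) Per) ×ˢ ((Finset.univ : Finset (Fin d)) ×ˢ (Finset.univ : Finset (Fin d))) with hS_def
  have hmemS : ∀ (z : Site d) (i j : Fin d), (cmod Per z, i, j) ∈ S := fun z i j => by
    rw [hS_def, Finset.mem_product, Finset.mem_product]
    exact ⟨(mem_periodBox).2 fun k => ⟨cmod_nonneg hPer z k, cmod_lt hPer z k⟩, Finset.mem_univ _, Finset.mem_univ _⟩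
  have hSne : S.Nonempty := ⟨_, hmemS 0 ⟨0, hd⟩ ⟨0, hd⟩⟩
  obtain ⟨q₀, -, hq₀max⟩ := Finset.exists_max_image S (fun q => ‖cD W q.2.2 (fun w => A w q.2.1) q.1‖) hSne
  set G : ℝ := ‖cD W q₀.2.2 (fun w => A w q₀.2.1) q₀.1‖ with hG_def
  have hper : ∀ (i j : Fin d) (z : Site d) (k : Fin d), cD W j (fun w => A w i) (z + (Per : ℤ) • e k) = cD W j (fun w => A w i) z :=
    fun i j z k => cD_periodic hWP j (fun w k' => hAP w k' i) z k
  have hGall : ∀ (z : Site d) (j i : Fin d), ‖cD W j (fun w => A w i) z‖ ≤ G := by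
    intro z j i
    have hz : z = cmod Per z + (Per : ℤ) • SkeletonLattice.cdiv Per z := by rw [add_comm, smul_cdiv_add_cmod]
    have h1 : cD W j (fun w => A w i) z = cD W j (fun w => A w i) (cmod Per z) := by
      have h := periodic_smul_vec (f := fun w => cD W j (fun w' => A w' i) w) (N := (Per : ℤ)) (hper i j) (cmod Per z) (SkeletonLattice.cdiv Per z)
      rwa [← hz] at h
    rw [h1]
    have hm := hq₀max (cmod Per z, i, j) (hmemS z i j)
    simpa only using hm
  -- the rough covariant Laplacian from the Hodge data (F117)
  have hB : ∀ (z : Site d) (i : Fin d), ‖∑ μ, (cD W μ (fun w => A w i) z + cDstar W μ (fun w => A w i) z)‖ ≤ J + P + 2 * d * x * U :=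
    fun z i => norm_covLap_le_hodge hW hx hWx A hU z i (hJ z i) (hP z i)
  -- F116b at the maximising bond
  have hkey := norm_cD_le_of_covLap_sharp hW hx hx₁ hWx hgrad (fun w => A w q₀.2.1) (fun w => hU w _) (fun z τ' => hGall z τ' q₀.2.1)
    (fun z => hB z q₀.2.1) hR q₀.1 q₀.2.2
  rw [← hG_def] at hkey
  -- absorb the `G`-term
  have hR1 : (1 : ℝ) ≤ R := by exact_mod_cast hR
  have hU0 : 0 ≤ U := (norm_nonneg _).trans (hU 0 ⟨0, hd⟩)
  have hG0 : 0 ≤ G := norm_nonneg _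
  have ha0 : 0 ≤ 2 * (d : ℝ) * (R + 1) * x := by positivity
  have hsplit : 2 * ((d : ℝ) * U / R + R * ((J + P + 2 * d * x * U)
        + 2 * (2 * (d : ℝ) ^ 2 * (R + 1) * x₁ + 8 * (d : ℝ) ^ 3 * ((R : ℝ) + 1) ^ 2 * x ^ 2) * U
        + 4 * (d : ℝ) * (2 * (d : ℝ) * (R + 1) * x) * (G + 2 * (2 * (d : ℝ) * (R + 1) * x) * U) + 4 * (d : ℝ) * (2 * (d : ℝ) * (R + 1) * x) ^ 2 * U))
        + 2 * (2 * (d : ℝ) * (R + 1) * x) * U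
      = (2 * ((d : ℝ) * U / R + R * (J + P + 2 * d * x * U))
          + (2 * R * (2 * (2 * (d : ℝ) ^ 2 * (R + 1) * x₁ + 8 * (d : ℝ) ^ 3 * ((R : ℝ) + 1) ^ 2 * x ^ 2) + 12 * (d : ℝ) * (2 * (d : ℝ) * (R + 1) * x) ^ 2)
              + 2 * (2 * (d : ℝ) * (R + 1) * x)) * U)
        + G * (8 * R * (d : ℝ) * (2 * (d : ℝ) * (R + 1) * x)) := by ring
  rw [hsplit] at hkey
  have habs : G * (8 * R * (d : ℝ) * (2 * (d : ℝ) * (R + 1) * x)) ≤ G * (1 / 2) := by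
    refine mul_le_mul_of_nonneg_left ?_ hG0
    linarith
  have hJ0 : 0 ≤ J := (norm_nonneg _).trans (hJ 0 ⟨0, hd⟩)
  have hP0 : 0 ≤ P := (norm_nonneg _).trans (hP 0 ⟨0, hd⟩)
  have hGle : G ≤ 4 * ((d : ℝ) * U / R + R * (J + P + 2 * d * x * U))
        + (4 * R * (2 * (2 * (d : ℝ) ^ 2 * (R + 1) * x₁ + 8 * (d : ℝ) ^ 3 * ((R : ℝ) + 1) ^ 2 * x ^ 2) + 12 * (d : ℝ) * (2 * (d : ℝ) * (R + 1) * x) ^ 2)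
            + 4 * (2 * (d : ℝ) * (R + 1) * x)) * U := by nlinarith
  exact (hGall y τ ν).trans hGle

end

end Summit.QuantumFields.BalabanUV.T4Continuum.NE7CovariantOneFormSupRegularity
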